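import Literature.Geometry.Kaehler.RiemannSurfaceLogDerivativeForm
import Literature.Geometry.Kaehler.RiemannSurfaceAbelTheoremChains
import HarnessLib

/-!
# The weak solution of a CLOSED chain of arcs is a nowhere-vanishing smooth function, and its
# logarithmic differential pairs with the holomorphic differentials like the chain form
# (Forster §20.4–20.5, Lemma 20.5 for closed curves)

Layer `Literature/Geometry/Kaehler`, sequel of `RiemannSurfaceAbelTheoremChains` (chains of arcs
`c : ι → ArcDatum M`, their boundary divisor `chainDivisor c = ∑ ∂cᵢ`, the product `chainUnit c = ∏ fᵢ`
of the weak solutions, the smooth `(0,1)`-form `chainForm c = ∑ σᵢ` with `dz̄`-coefficient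
`chainCoeff c`, and the local structure `fᵢ ∘ z_x⁻¹ = (z - z_x x)^{∂cᵢ(x)} · V`) and of
`RiemannSurfaceLogDerivativeForm` (the smooth closed `1`-form `logDerivForm u = (2πi)⁻¹ u⁻¹ du`).

O. Forster, *Lectures on Riemann Surfaces*, GTM 81 (1981), §20.4–20.5: for a CLOSED curve `c`
(`∂c = 0`) the product `f = ∏ fᵢ` of the weak solutions of its pieces is a weak solution of the zero
divisor, i.e. (20.4) a smooth function without zeros, and Lemma 20.5 reads
`∫_c ω = (1/2πi) ∬_X (df/f) ∧ ω`.  Here, for a chain with `chainDivisor c = 0`: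

* §1 the local structure of the weak solution of one arc with a SMOOTH (indeed analytic) unit `V`
  (`ArcDatum.exists_contDiffAt_unit_comp_symm_eq_zpow_mul`, sharpening the tree's continuous version),
  and of the chain (`exists_contDiffAt_chainUnit_comp_symm_eq_zpow_mul`);
* §2 **`closedChainUnit c`**: the product `∏ fᵢ` with its removable singularities at the endpoints
  filled in; it is nowhere zero (`closedChainUnit_ne_zero`), agrees with `chainUnit c` off the endpoints,
  and is `C^∞` in every chart when `chainDivisor c = 0` (**`contDiffAt_closedChainUnit`**);
* §3 its logarithmic `∂̄`-derivative off the endpoints is the chain coefficient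
  (`logDerivCoeffZbar_closedChainUnit`), whence — smooth forms that agree off a finite set are equal,
  `MForm.eq_of_isSmoothForm_of_forall_not_mem_finite` — **`oneZeroForm_wedge_logDerivForm_closedChainUnit`**:
  `θ dz ∧ (2πi)⁻¹ u⁻¹ du = θ dz ∧ σ_c` for every holomorphic `θ` (the integrand of Lemma 20.5);
* §4 the same for the unitisation `u/|u|` up to the exact form `(2πi)⁻¹ θ dz ∧ d log|u|`
  (`oneZeroForm_wedge_logDerivForm_unitize_closedChainUnit`).

Everything is proved; the definitions (`ArcDatum.smoothUnitFactor`-free: only `closedChainUnit`) have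
bodies; no instances, no named facts.

## References

* O. Forster, *Lectures on Riemann Surfaces*, GTM 81, Springer (1981), §20.4 (weak solutions; «in the
  case `a = b` a weak solution is a smooth function without zeros»), Lemma 20.5, Theorem 20.7 (proof).
  [Forster1981]
* R. Miranda, *Algebraic Curves and Riemann Surfaces*, GSM 5 (1995), Chapter II Lemma 1.28 (orders and
  removable singularities). [Miranda1995]
-/

noncomputable section

open scoped Manifold ContDiff Topology ComplexConjugate Real
open Set Filter Function Complex Metric
open Literature.NumberTheory.Transcendental Literature.Analysis.Complex

namespace Literature.Geometry.Kaehler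

namespace RiemannSurface

variable {M : Type*} [TopologicalSpace M] [ChartedSpace ℂ M]

/-! ### §1 Local structure with a smooth unit -/

namespace ArcDatum

variable [IsManifold 𝓘(ℂ, ℂ) ω M] (A : ArcDatum M)

/-- **Local structure of the weak solution of an arc at every point, with a `C^∞` unit**: in the chart
`z_x`, `f ∘ z_x⁻¹ = (z - z_x x)^{∂c(x)} · V` on a punctured neighbourhood, with `V` `C^∞` at `z_x x`
and `V(z_x x) ≠ 0` (at the endpoints `V` is a quotient of the analytic transition data
`dslope T`, `T z - a`; elsewhere `V = f ∘ z_x⁻¹` itself). [cite: Forster1981, §20.4 (Definition of a weak solution)] -/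
theorem exists_contDiffAt_unit_comp_symm_eq_zpow_mul [T2Space M] (x : M) :
    ∃ V : ℂ → ℂ, ContDiffAt ℝ ∞ V (chartAt ℂ x x) ∧ V (chartAt ℂ x x) ≠ 0 ∧
      ∀ᶠ z in 𝓝[≠] (chartAt ℂ x x),
        (A.unit ∘ (chartAt ℂ x).symm) z = (z - chartAt ℂ x x) ^ (A.divisor x) * V z := by
  set z₀ := chartAt ℂ x x with hz₀
  set T : ℂ → ℂ := chartAt ℂ A.center ∘ (chartAt ℂ x).symm with hT
  by_cases h2 : x = A.tgtPt
  · -- simple zero at `b'`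
    subst h2
    have hx := A.tgtPt_mem_source
    obtain ⟨hTa, hT'⟩ := A.analyticAt_transition hx
    have hTb : T z₀ = A.tgt := by simp [hT, hz₀, (chartAt ℂ A.tgtPt).left_inv (mem_chart_source ℂ _)]
    have hba : A.tgt - A.src ≠ 0 := sub_ne_zero.2 A.src_ne_tgt.symm
    have hds : AnalyticAt ℂ (dslope T z₀) z₀ := by
      obtain ⟨p, hp⟩ := hTa
      exact ⟨_, hp.has_fpower_series_dslope_fslope⟩
    refine ⟨fun z ↦ dslope T z₀ z / (T z - A.src), ?_, ?_, ?_⟩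
    · have hnum : ContDiffAt ℝ ∞ (dslope T z₀) z₀ := hds.contDiffAt.restrict_scalars ℝ
      have hden : ContDiffAt ℝ ∞ (fun z ↦ T z - A.src) z₀ := (hTa.contDiffAt.restrict_scalars ℝ).sub contDiffAt_const
      have hden0 : T z₀ - A.src ≠ 0 := by rw [hTb]; exact hba
      have h := hnum.mul (hden.inv hden0)
      exact h.congr_of_eventuallyEq (Eventually.of_forall fun z ↦ div_eq_mul_inv _ _)
    · show dslope T z₀ z₀ / (T z₀ - A.src) ≠ 0
      rw [dslope_same, hTb]
      exact div_ne_zero hT' hba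
    · have hev := A.unit_comp_symm_eventuallyEq_div_transition hx (by
        rw [chartAt_tgtPt]; exact A.tgt_mem_ball_r₁)
      filter_upwards [hev.filter_mono nhdsWithin_le_nhds, self_mem_nhdsWithin] with z hz (hzz : z ≠ z₀)
      rw [hz, divisor_tgtPt, zpow_one]
      change (T z - A.tgt) / (T z - A.src) = (z - z₀) * (dslope T z₀ z / (T z - A.src))
      rw [← hTb, ← sub_smul_dslope T z₀ z, smul_eq_mul]
      ring
  by_cases h1 : x = A.srcPt
  · -- simple pole at `a'`
    subst h1
    have hx := A.srcPt_mem_source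
    obtain ⟨hTa, hT'⟩ := A.analyticAt_transition hx
    have hTa' : T z₀ = A.src := by simp [hT, hz₀, (chartAt ℂ A.srcPt).left_inv (mem_chart_source ℂ _)]
    have hab : A.src - A.tgt ≠ 0 := sub_ne_zero.2 A.src_ne_tgt
    have hdsA : AnalyticAt ℂ (dslope T z₀) z₀ := by
      obtain ⟨p, hp⟩ := hTa
      exact ⟨_, hp.has_fpower_series_dslope_fslope⟩
    have hds0 : dslope T z₀ z₀ ≠ 0 := by rwa [dslope_same]
    refine ⟨fun z ↦ (T z - A.tgt) / dslope T z₀ z, ?_, ?_, ?_⟩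
    · have hnum : ContDiffAt ℝ ∞ (fun z ↦ T z - A.tgt) z₀ := (hTa.contDiffAt.restrict_scalars ℝ).sub contDiffAt_const
      have hden : ContDiffAt ℝ ∞ (dslope T z₀) z₀ := hdsA.contDiffAt.restrict_scalars ℝ
      have h := hnum.mul (hden.inv hds0)
      exact h.congr_of_eventuallyEq (Eventually.of_forall fun z ↦ div_eq_mul_inv _ _)
    · show (T z₀ - A.tgt) / dslope T z₀ z₀ ≠ 0
      rw [dslope_same, hTa']
      exact div_ne_zero hab hT'
    · have hev := A.unit_comp_symm_eventuallyEq_div_transition hx (by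
        rw [chartAt_srcPt]; exact A.src_mem_ball_r₁)
      have hne : ∀ᶠ z in 𝓝 z₀, dslope T z₀ z ≠ 0 := hdsA.continuousAt.eventually_ne hds0
      filter_upwards [hev.filter_mono nhdsWithin_le_nhds, hne.filter_mono nhdsWithin_le_nhds,
        self_mem_nhdsWithin] with z hz hzne (hzz : z ≠ z₀)
      rw [hz, divisor_srcPt, zpow_neg, zpow_one]
      change (T z - A.tgt) / (T z - A.src) = (z - z₀)⁻¹ * ((T z - A.tgt) / dslope T z₀ z)
      have hTz : T z - A.src = (z - z₀) * dslope T z₀ z := by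
        rw [← hTa', ← sub_smul_dslope T z₀ z, smul_eq_mul]
      rw [hTz]
      have hzz' : z - z₀ ≠ 0 := sub_ne_zero.2 hzz
      field_simp
  · -- a unit elsewhere
    refine ⟨A.unit ∘ (chartAt ℂ x).symm, A.contDiffAt_unit_comp_symm h1, ?_, ?_⟩
    · show A.unit ((chartAt ℂ x).symm (chartAt ℂ x x)) ≠ 0
      rw [(chartAt ℂ x).left_inv (mem_chart_source ℂ x)]
      exact A.unit_ne_zero h1 h2
    · filter_upwards with z
      rw [A.divisor_of_ne h1 h2, zpow_zero, one_mul]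

end ArcDatum

/-! ### §2 The corrected weak solution of a closed chain -/

section Chain

variable {ι : Type*} [Fintype ι] (c : ι → ArcDatum M) [IsManifold 𝓘(ℂ, ℂ) ω M] [T2Space M]

/-- **Local structure of `∏ fᵢ` with a smooth unit**: `(∏ fᵢ) ∘ z_x⁻¹ = (z - z_x x)^{∂c(x)} · V` on a
punctured neighbourhood, `V` `C^∞` at `z_x x`, `V(z_x x) ≠ 0`. [cite: Forster1981, §20.4 and Theorem 20.7 (proof)] -/
theorem exists_contDiffAt_chainUnit_comp_symm_eq_zpow_mul (x : M) :
    ∃ V : ℂ → ℂ, ContDiffAt ℝ ∞ V (chartAt ℂ x x) ∧ V (chartAt ℂ x x) ≠ 0 ∧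
      ∀ᶠ z in 𝓝[≠] (chartAt ℂ x x),
        (chainUnit c ∘ (chartAt ℂ x).symm) z = (z - chartAt ℂ x x) ^ (chainDivisor c x) * V z := by
  set e := chartAt ℂ x with he
  set z₀ := e x with hz₀
  have h : ∀ i, ∃ V : ℂ → ℂ, ContDiffAt ℝ ∞ V z₀ ∧ V z₀ ≠ 0 ∧ ∀ᶠ z in 𝓝[≠] z₀,
      ((c i).unit ∘ e.symm) z = (z - z₀) ^ ((c i).divisor x) * V z := fun i ↦
    (c i).exists_contDiffAt_unit_comp_symm_eq_zpow_mul x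
  choose V hVc hV0 hV using h
  refine ⟨fun z ↦ ∏ i, V i z, contDiffAt_prod (fun i _ ↦ hVc i), Finset.prod_ne_zero_iff.2 fun i _ ↦ hV0 i, ?_⟩
  have hall : ∀ᶠ z in 𝓝[≠] z₀, ∀ i, ((c i).unit ∘ e.symm) z = (z - z₀) ^ ((c i).divisor x) * V i z :=
    Filter.eventually_all.2 hV
  filter_upwards [hall, self_mem_nhdsWithin] with z hz (hzz : z ≠ z₀)
  change (∏ i, ((c i).unit ∘ e.symm) z) = (z - z₀) ^ (chainDivisor c x) * ∏ i, V i z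
  rw [Finset.prod_congr rfl fun i _ ↦ hz i, Finset.prod_mul_distrib,
    prod_zpow_eq_zpow_sum _ (sub_ne_zero.2 hzz), chainDivisor_apply]

/-- **The corrected weak solution of a chain**: `∏ fᵢ` off the endpoints, and at an endpoint `x` the
value `V(z_x x)` of the smooth unit of its local structure (the removable singularity filled in — for a
closed chain, Forster's «smooth function without zeros»). [cite: Forster1981, §20.4] -/
def closedChainUnit (x : M) : ℂ := by
  classical
  exact if IsEndpoint c x then
    Classical.choose (exists_contDiffAt_chainUnit_comp_symm_eq_zpow_mul c x) (chartAt ℂ x x)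
  else chainUnit c x

/-- Off the endpoints the corrected weak solution is `∏ fᵢ`. [cite: Forster1981, §20.4] -/
theorem closedChainUnit_of_not_isEndpoint {x : M} (hx : ¬ IsEndpoint c x) :
    closedChainUnit c x = chainUnit c x := by
  classical
  simp [closedChainUnit, hx]

/-- At an endpoint the corrected weak solution is the value of the chosen smooth unit.
[cite: Forster1981, §20.4] -/
theorem closedChainUnit_of_isEndpoint {x : M} (hx : IsEndpoint c x) :
    closedChainUnit c x =
      Classical.choose (exists_contDiffAt_chainUnit_comp_symm_eq_zpow_mul c x) (chartAt ℂ x x) := by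
  classical
  simp [closedChainUnit, hx]

/-- **The corrected weak solution has no zeros.** [cite: Forster1981, §20.4 («a smooth function without zeros»)] -/
theorem closedChainUnit_ne_zero (x : M) : closedChainUnit c x ≠ 0 := by
  by_cases hx : IsEndpoint c x
  · rw [closedChainUnit_of_isEndpoint c hx]
    exact (Classical.choose_spec (exists_contDiffAt_chainUnit_comp_symm_eq_zpow_mul c x)).2.1
  · rw [closedChainUnit_of_not_isEndpoint c hx]
    exact chainUnit_ne_zero c hx

/-- Near a non-endpoint the corrected weak solution is `∏ fᵢ`. [cite: Forster1981, §20.4] -/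
theorem closedChainUnit_eventuallyEq_chainUnit {x : M} (hx : ¬ IsEndpoint c x) :
    closedChainUnit c =ᶠ[𝓝 x] chainUnit c := by
  have ho : IsOpen {y | IsEndpoint c y}ᶜ := (finite_setOf_isEndpoint c).isClosed.isOpen_compl
  filter_upwards [ho.mem_nhds hx] with y hy using closedChainUnit_of_not_isEndpoint c hy

/-- `∏ fᵢ` is `C^∞` in the charts at a non-endpoint. [cite: Forster1981, §20.4] -/
theorem contDiffAt_chainUnit_comp_symm {x : M} (hx : ¬ IsEndpoint c x) :
    ContDiffAt ℝ ∞ (chainUnit c ∘ (chartAt ℂ x).symm) (chartAt ℂ x x) := by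
  have h1 : ∀ i, x ≠ (c i).srcPt := fun i h ↦ hx ⟨i, Or.inl h⟩
  have h := contDiffAt_prod (t := (Finset.univ : Finset ι))
    (f := fun i ↦ (c i).unit ∘ (chartAt ℂ x).symm) (x := chartAt ℂ x x) (n := ∞) (𝕜 := ℝ)
    fun i _ ↦ (c i).contDiffAt_unit_comp_symm (h1 i)
  refine h.congr_of_eventuallyEq (Eventually.of_forall fun z ↦ ?_)
  simp [chainUnit]

/-- **For a closed chain the corrected weak solution is `C^∞` in every chart** (`∂c = 0`: at an endpoint
the local structure has exponent `0`, so `u ∘ z_x⁻¹` coincides near `z_x x` with the smooth unit `V`).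
[cite: Forster1981, §20.4 («in the case `a = b` … a smooth function without zeros»)] -/
theorem contDiffAt_closedChainUnit (h0 : chainDivisor c = 0) (x : M) :
    ContDiffAt ℝ ∞ (closedChainUnit c ∘ (chartAt ℂ x).symm) (chartAt ℂ x x) := by
  by_cases hx : IsEndpoint c x
  · set V := Classical.choose (exists_contDiffAt_chainUnit_comp_symm_eq_zpow_mul c x) with hVdef
    obtain ⟨hVc, -, hVev⟩ := Classical.choose_spec (exists_contDiffAt_chainUnit_comp_symm_eq_zpow_mul c x)
    have hnot : ∀ᶠ z in 𝓝[≠] (chartAt ℂ x x), ¬ IsEndpoint c ((chartAt ℂ x).symm z) :=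
      (tendsto_chartAt_symm_nhdsNE x).eventually (eventually_not_isEndpoint c x)
    have hpunct : ∀ᶠ z in 𝓝[≠] (chartAt ℂ x x), (closedChainUnit c ∘ (chartAt ℂ x).symm) z = V z := by
      filter_upwards [hnot, hVev] with z hz hV
      rw [comp_apply, closedChainUnit_of_not_isEndpoint c hz]
      have hcx : chainDivisor c x = 0 := by rw [h0]; rfl
      have hpow : (z - chartAt ℂ x x) ^ (chainDivisor c x) = 1 := by rw [hcx, zpow_zero]
      have h := hV
      rw [comp_apply, hpow, one_mul] at h
      exact h
    have hat : (closedChainUnit c ∘ (chartAt ℂ x).symm) (chartAt ℂ x x) = V (chartAt ℂ x x) := by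
      rw [comp_apply, (chartAt ℂ x).left_inv (mem_chart_source ℂ x), closedChainUnit_of_isEndpoint c hx]
    have hev : (closedChainUnit c ∘ (chartAt ℂ x).symm) =ᶠ[𝓝 (chartAt ℂ x x)] V := by
      have h' := eventually_nhdsWithin_iff.1 hpunct
      filter_upwards [h'] with z hz
      by_cases hzz : z = chartAt ℂ x x
      · rw [hzz]; exact hat
      · exact hz hzz
    exact hVc.congr_of_eventuallyEq hev
  · have hev : closedChainUnit c ∘ (chartAt ℂ x).symm =ᶠ[𝓝 (chartAt ℂ x x)] chainUnit c ∘ (chartAt ℂ x).symm := by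
      have h := (chartAt ℂ x).continuousAt_symm (mem_chart_target ℂ x)
      rw [ContinuousAt, (chartAt ℂ x).left_inv (mem_chart_source ℂ x)] at h
      exact h.eventually (closedChainUnit_eventuallyEq_chainUnit c hx) |>.mono fun z hz ↦ by
        simp only [comp_apply, hz]
    exact (contDiffAt_chainUnit_comp_symm c hx).congr_of_eventuallyEq hev

/-- Differentiable version. [cite: Forster1981, §20.4] -/
theorem differentiableAt_closedChainUnit (h0 : chainDivisor c = 0) (x : M) :
    DifferentiableAt ℝ (closedChainUnit c ∘ (chartAt ℂ x).symm) (chartAt ℂ x x) :=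
  (contDiffAt_closedChainUnit c h0 x).differentiableAt (by simp)

/-! ### §3 The logarithmic `∂̄`-derivative is the chain coefficient; the wedge with `Ω(M)` -/

/-- **`∂̄ log(∏ fᵢ) = 2πi q`** in the preferred chart at a non-endpoint `x`, `q = chainCoeff c` the
`dz̄`-coefficient of `σ = ∑ σᵢ` (`dbarAlong_unit` summed over the arcs). [cite: Forster1981, §20.5 (proof, part (a)) and Theorem 20.7 (proof)] -/
theorem dbarAlong_chainUnit_comp_symm {x : M} (hx : ¬ IsEndpoint c x) :
    dbarAlong 1 (chainUnit c ∘ (chartAt ℂ x).symm) (chartAt ℂ x x) = 2 * π * I * chainCoeff c x * chainUnit c x := by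
  set e := chartAt ℂ x with he
  have h1 : ∀ i, x ≠ (c i).srcPt := fun i h ↦ hx ⟨i, Or.inl h⟩
  obtain ⟨-, hP⟩ := differentiableAt_and_dbarAlong_finset_prod (Finset.univ : Finset ι)
    (g := fun i ↦ (c i).unit ∘ e.symm) (k := fun i ↦ 2 * π * I * chartCoeffBar (c i).center (c i).coeff x)
    (z := e x) (fun i _ ↦ (c i).differentiableAt_unit_comp_symm (h1 i)) (fun i _ ↦ by
      rw [(c i).dbarAlong_unit (h1 i), comp_apply, e.left_inv (mem_chart_source ℂ x)]; ring)
  have hfun : chainUnit c ∘ e.symm = fun w ↦ ∏ i, ((c i).unit ∘ e.symm) w := by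
    funext w; simp [chainUnit]
  rw [hfun, hP, chainCoeff, ← Finset.mul_sum]
  simp only [comp_apply, e.left_inv (mem_chart_source ℂ x), chainUnit]

/-- **Off the endpoints, the `dz̄`-coefficient of `(2πi)⁻¹ u⁻¹ du` is the chain coefficient `q`**
(`u = closedChainUnit c`). [cite: Forster1981, Lemma 20.5 (proof, part (a))] -/
theorem logDerivCoeffZbar_closedChainUnit {x : M} (hx : ¬ IsEndpoint c x) :
    logDerivCoeffZbar (closedChainUnit c) x = chainCoeff c x := by
  have hev : closedChainUnit c ∘ (chartAt ℂ x).symm =ᶠ[𝓝 (chartAt ℂ x x)] chainUnit c ∘ (chartAt ℂ x).symm := by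
    have h := (chartAt ℂ x).continuousAt_symm (mem_chart_target ℂ x)
    rw [ContinuousAt, (chartAt ℂ x).left_inv (mem_chart_source ℂ x)] at h
    exact h.eventually (closedChainUnit_eventuallyEq_chainUnit c hx) |>.mono fun z hz ↦ by
      simp only [comp_apply, hz]
  rw [logDerivCoeffZbar_apply, dbarAlong_congr_of_eventuallyEq hev 1, dbarAlong_chainUnit_comp_symm c hx,
    closedChainUnit_of_not_isEndpoint c hx]
  have h2 : (2 * π * I : ℂ) ≠ 0 := by
    have : (π : ℂ) ≠ 0 := by exact_mod_cast Real.pi_ne_zero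
    simp [this, I_ne_zero]
  field_simp [chainUnit_ne_zero c hx]

omit [IsManifold 𝓘(ℂ, ℂ) ω M] [T2Space M] [Fintype ι] in
/-- **Smooth forms that agree off a finite set are equal** (at a point of the finite set, the chart
representative of the difference is continuous and vanishes on a punctured neighbourhood).
[cite: Forster1981, §9.8] -/
theorem _root_.Literature.Geometry.Kaehler.MForm.eq_of_isSmoothForm_of_forall_not_mem_finite
    [IsManifold 𝓘(ℝ, ℂ) ∞ M] [T2Space M] {k : ℕ}
    {α β : MForm 𝓘(ℝ, ℂ) M ℂ k} (hα : IsSmoothForm α) (hβ : IsSmoothForm β) {S : Set M} (hS : S.Finite)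
    (h : ∀ x, x ∉ S → α x = β x) : α = β := by
  -- the difference `γ` is smooth and vanishes off `S`
  set γ := α - β with hγ
  have hγs : IsSmoothForm γ := by
    rw [hγ, sub_eq_add_neg, ← neg_one_smul ℝ β]; exact hα.add (hβ.smul (-1))
  have hγ0 : ∀ x, x ∉ S → γ x = 0 := fun x hx ↦ by rw [hγ, Pi.sub_apply, h x hx, sub_self]
  suffices hzero : ∀ x, γ x = 0 by
    funext x; have := hzero x; rw [hγ, Pi.sub_apply, sub_eq_zero] at this; exact this
  intro x
  by_cases hx : x ∈ S
  swap
  · exact hγ0 x hx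
  set z₀ := extChartAt 𝓘(ℝ, ℂ) x x with hz₀
  -- the representative is continuous at `z₀`
  have hcont : ContinuousAt (γ.inChart x) z₀ := by
    have h1 := hγs x
    rw [ModelWithCorners.Boundaryless.range_eq_univ, contDiffWithinAt_univ] at h1
    exact h1.continuousAt
  -- and vanishes on a punctured neighbourhood of `z₀`
  have htgt : ∀ᶠ y in 𝓝 z₀, y ∈ (extChartAt 𝓘(ℝ, ℂ) x).target :=
    (isOpen_extChartAt_target x).mem_nhds (mem_extChartAt_target x)
  have hsymm : ContinuousAt (extChartAt 𝓘(ℝ, ℂ) x).symm z₀ := continuousAt_extChartAt_symm x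
  have havoid : ∀ᶠ y in 𝓝 z₀, ∀ s ∈ S \ {x}, (extChartAt 𝓘(ℝ, ℂ) x).symm y ≠ s := by
    refine (hS.subset Set.sdiff_subset).eventually_all.2 fun s hs ↦ ?_
    have hne : (extChartAt 𝓘(ℝ, ℂ) x).symm z₀ ≠ s := by
      rw [hz₀, extChartAt_to_inv]; exact fun h ↦ hs.2 (h ▸ rfl)
    exact hsymm.eventually_ne hne
  have hpunct : ∀ᶠ y in 𝓝[≠] z₀, γ.inChart x y = 0 := by
    have h1 : ∀ᶠ y in 𝓝[≠] z₀, y ∈ (extChartAt 𝓘(ℝ, ℂ) x).target ∧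
        ∀ s ∈ S \ {x}, (extChartAt 𝓘(ℝ, ℂ) x).symm y ≠ s := (htgt.and havoid).filter_mono nhdsWithin_le_nhds
    filter_upwards [h1, self_mem_nhdsWithin] with y hy (hyz : y ≠ z₀)
    have hyS : (extChartAt 𝓘(ℝ, ℂ) x).symm y ∉ S := by
      intro hmem
      by_cases heq : (extChartAt 𝓘(ℝ, ℂ) x).symm y = x
      · exact hyz (by rw [← (extChartAt 𝓘(ℝ, ℂ) x).right_inv hy.1, heq])
      · exact hy.2 _ ⟨hmem, heq⟩ rfl
    rw [γ.inChart_eq_of_mem_target hy.1, hγ0 _ hyS]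
    ext m
    rw [ContinuousAlternatingMap.compContinuousLinearMap_apply]
    rfl
  -- hence vanishes at `z₀`
  have hlim : Tendsto (γ.inChart x) (𝓝[≠] z₀) (𝓝 0) :=
    tendsto_const_nhds.congr' (hpunct.mono fun y hy ↦ hy.symm)
  have hval : γ.inChart x z₀ = 0 :=
    tendsto_nhds_unique (hcont.tendsto.mono_left nhdsWithin_le_nhds) hlim
  rw [← MForm.inChart_apply_self γ x, ← hz₀]
  exact hval

variable [IsManifold 𝓘(ℝ, ℂ) ∞ M]

/-- **`θ dz ∧ (2πi)⁻¹ u⁻¹ du = θ dz ∧ σ_c`** for the corrected weak solution `u` of a CLOSED chain and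
every holomorphic `θ`: both are smooth `2`-forms and they agree off the endpoints (the integrand of
Forster's Lemma 20.5, «`(1/2πi) ∬ (df/f) ∧ ω`», equals `∬ σ ∧ ω`).
[cite: Forster1981, Lemma 20.5 and Theorem 20.7 (proof)] -/
theorem oneZeroForm_wedge_logDerivForm_closedChainUnit (h0 : chainDivisor c = 0)
    {θ : MeromorphicOneForm M} (hθ : θ.IsHolomorphic) :
    (oneZeroForm ⇑θ).wedge (logDerivForm (closedChainUnit c)) = (oneZeroForm ⇑θ).wedge (chainForm c) := by
  have hs1 : IsSmoothForm (oneZeroForm ⇑θ) := hθ.isSmoothForm_oneZeroForm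
  have hsu : IsSmoothForm (logDerivForm (closedChainUnit c)) :=
    isSmoothForm_logDerivForm (contDiffAt_closedChainUnit c h0) (closedChainUnit_ne_zero c)
  refine MForm.eq_of_isSmoothForm_of_forall_not_mem_finite (IsSmoothFormWedge_holds 𝓘(ℝ, ℂ) M ℂ hs1 hsu)
    (IsSmoothFormWedge_holds 𝓘(ℝ, ℂ) M ℂ hs1 (isSmoothForm_chainForm c)) (finite_setOf_isEndpoint c)
    fun x hx ↦ ?_
  rw [oneZeroForm_wedge_logDerivForm, oneZeroForm_wedge, coeffZeroOne_chainForm]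
  ext v
  simp only [oneOneForm_apply, Pi.mul_apply, logDerivCoeffZbar_closedChainUnit c hx]

/-- **The unitised version**: for `v = u/|u|`,
`θ dz ∧ (2πi)⁻¹ v⁻¹ dv + (2πi)⁻¹ θ dz ∧ d(log|u|) = θ dz ∧ σ_c` — the same pairing up to the exact form
`θ dz ∧ d(log|u|)`. [cite: Forster1981, Lemma 20.5 and Theorem 20.7 (proof)] -/
theorem oneZeroForm_wedge_logDerivForm_unitize_closedChainUnit (h0 : chainDivisor c = 0)
    {θ : MeromorphicOneForm M} (hθ : θ.IsHolomorphic) :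
    (oneZeroForm ⇑θ).wedge (logDerivForm (unitize (closedChainUnit c))) +
        (oneZeroForm ⇑θ).wedge ((2 * π * I)⁻¹ • mextDeriv (MForm.ofFun 𝓘(ℝ, ℂ) (logNorm (closedChainUnit c)))) =
      (oneZeroForm ⇑θ).wedge (chainForm c) := by
  rw [← MForm.wedge_add_right, logDerivForm_unitize (differentiableAt_closedChainUnit c h0)
    (closedChainUnit_ne_zero c), sub_add_cancel, oneZeroForm_wedge_logDerivForm_closedChainUnit c h0 hθ]

end Chain

end RiemannSurface

end Literature.Geometry.Kaehler

end
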